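import Literature.Geometry.Lorentzian.CoordTensorWaveExistence
import Literature.Geometry.Lorentzian.CoordKillingCauchyData
import Literature.Geometry.Lorentzian.CoordGaussianSliceMap
import Literature.Geometry.Lorentzian.CoordConstraintCongr
import Mathlib.Analysis.Calculus.BumpFunction.FiniteDimension
import HarnessLib

/-!
# Killing initial data develop into coordinate Killing fields (Moncrief 1975, in a Gaussian chart)

The coordinate core of Moncrief's theorem "KIDs are the Cauchy data of Killing fields of the
vacuum development" (Moncrief, J. Math. Phys. 16 (1975), Thm. of §III; Fischer–Marsden–Moncrief
1980, Lemma 2.2), assembled from the tree's pieces: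

* the tensor wave existence theorem `IsMetricOn.exists_tensorWave_solution`
  (`CoordTensorWaveExistence.lean`) produces a smooth covector field `Θ` with `□Θ = 0` near the
  slice and the KID Cauchy data `Θ(e₀) = −2N`, `Θ(ṽ) = h(Y, v)`, `∂_tΘ(e₀) = 0`,
  `∂_tΘ(ṽ) = 2∂_vN + 2K(v, Y)` (`IsKIDCauchyData`);
* `deform_cauchyData_eq_zero` (`CoordKillingCauchyData.lean`): the Killing defect
  `A = ∇Θ + (∇Θ)ᵗ` and `∂_t A` vanish on the slice (this is where the KID equations and the
  vacuum constraints enter);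
* `IsMetricOn.tlap_deform_eq_of_tlap_eq_zero` (`CoordDeformationWave.lean`): `□A = −(X + Xᵗ)·A`;
* `IsMetricOn.eventually_eq_zero_of_tlap_eq` (`CoordTensorWaveUniqueness.lean`): hence `A = 0`
  near the slice, i.e. `ξ = Θ^♯` satisfies the coordinate Killing equation
  `DG(ξ)(v,w) + G(Dξ v, w) + G(v, Dξ w) = 0` there.

Main result `GaussSlice.exists_coordKilling_of_kid`: for Gaussian-slice vacuum components `G` on
`T ⊆ ℝ × E3` with Riemannian, constraint-satisfying slice data on `B ∋ y₀`, there is `ρₛ > 0` such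
that KIDs `(N, Y)` of the slice data on any ball `B(y₀, ρ) ⊆ B`, `ρ ≤ ρₛ`, produce, for every
`ρ₁ < ρ` and every open `𝒩` containing the slice, an open `W₀ ⊆ T ∩ 𝒩` containing
`{0} × B(y₀, ρ₁)` and a smooth solution `ξ` of the coordinate Killing equation on `W₀` with
`ξ(0, y) = 0 ⇒ N y = 0 ∧ Y y = 0` on `B(y₀, ρ₁)`. Everything is proved; no named facts (D-0026).

## References

* V. Moncrief, *Spacetime symmetries and linearization stability of the Einstein equations. I*,
  J. Math. Phys. 16 (1975) 493–498, §III. [Moncrief1975]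
* A. E. Fischer, J. E. Marsden, V. Moncrief, Ann. Inst. H. Poincaré A 33 (1980) 147–194,
  Lemma 2.2. [FischerMarsdenMoncrief1980]
-/

noncomputable section

set_option maxSynthPendingDepth 3

open Set Function Filter Metric ContinuousLinearMap
open scoped Topology ContDiff

namespace Literature.Geometry.Lorentzian

namespace MetricCoord

open Literature.Analysis.PDE Literature.Analysis.PDE.VarWave GaussSlice

/-! ### Helpers: globalising compactly supported smooth functions -/

section Helpers

variable {W : Type*} [NormedAddCommGroup W] [NormedSpace ℝ W]

/-- A function `C^∞` on an open `U` vanishing off a closed `K ⊆ U` is `C^∞` everywhere. [folklore] -/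
theorem contDiff_of_contDiffOn_of_eq_zero {f : E3 → W} {U K : Set E3} (hU : IsOpen U) (hK : IsClosed K)
    (hKU : K ⊆ U) (hf : ContDiffOn ℝ ∞ f U) (h0 : ∀ y ∉ K, f y = 0) : ContDiff ℝ ∞ f := by
  refine contDiff_iff_contDiffAt.2 fun y ↦ ?_
  by_cases hy : y ∈ U
  · exact (hf y hy).contDiffAt (hU.mem_nhds hy)
  · have hyK : y ∉ K := fun h ↦ hy (hKU h)
    have hev : f =ᶠ[𝓝 y] fun _ ↦ 0 := by
      filter_upwards [hK.isOpen_compl.mem_nhds hyK] with z hz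
      exact h0 z hz
    exact (contDiffAt_const (c := (0 : W))).congr_of_eventuallyEq hev

omit [NormedSpace ℝ W] in
/-- Such a function has compact support when `K` is compact. [folklore] -/
theorem hasCompactSupport_of_eq_zero {f : E3 → W} {K : Set E3} (hK : IsCompact K)
    (h0 : ∀ y ∉ K, f y = 0) : HasCompactSupport f :=
  HasCompactSupport.intro hK h0

end Helpers

/-! ### The covector field with given components -/

section Covector

/-- **The covector field with components `S`** in the wave basis: `Θ_p = Σ_m S_p(m) eᵐ`. [folklore] -/
def covecOf (S : Pt 3 → (Unit → Option (Fin 3)) → ℝ) (p : Pt 3) : Pt 3 →L[ℝ] ℝ :=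
  ∑ m, S p (uidx m) • coordCLM (waveBasis 3) m

/-- `Θ_p(w) = Σ_m S_p(m) wᵐ`. [folklore] -/
theorem covecOf_apply (S : Pt 3 → (Unit → Option (Fin 3)) → ℝ) (p w : Pt 3) :
    covecOf S p w = ∑ m, S p (uidx m) * (waveBasis 3).coord m w := by
  simp [covecOf, coordCLM_apply]

/-- The components of `Θ` are `S`. [folklore] -/
theorem covecComp_covecOf (S : Pt 3 → (Unit → Option (Fin 3)) → ℝ) :
    covecComp (waveBasis 3) (covecOf S) = S := by
  funext p I
  rw [covecComp_apply, covecOf_apply]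
  have h : ∀ m, (waveBasis 3).coord m ((waveBasis 3) (I ())) = if m = I () then 1 else 0 := fun m ↦ by
    rw [Module.Basis.coord_apply, Module.Basis.repr_self, Finsupp.single_apply]
    by_cases hm : m = I () <;> simp [hm, eq_comm]
  simp only [h, mul_ite, mul_one, mul_zero, Finset.sum_ite_eq', Finset.mem_univ, if_true, uidx_eta]

/-- `Θ(e₀) = S(none)`. [folklore] -/
theorem covecOf_tvec (S : Pt 3 → (Unit → Option (Fin 3)) → ℝ) (p : Pt 3) :
    covecOf S p tvec = S p (uidx none) := by
  rw [covecOf_apply, Fintype.sum_option]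
  simp only [sliceBasis_coord_none, sliceBasis_coord_some]
  simp

/-- `Θ(ṽ) = Σᵢ S(some i) vᵢ`. [folklore] -/
theorem covecOf_svec (S : Pt 3 → (Unit → Option (Fin 3)) → ℝ) (p : Pt 3) (v : E3) :
    covecOf S p (svec v) = ∑ i, S p (uidx (some i)) * v i := by
  rw [covecOf_apply, Fintype.sum_option]
  simp only [sliceBasis_coord_none, sliceBasis_coord_some]
  simp [stdBasis, EuclideanSpace.basisFun_repr]

/-- `Θ` is `C^∞` when its components are. [folklore] -/
theorem contDiff_covecOf {S : Pt 3 → (Unit → Option (Fin 3)) → ℝ} (hS : ∀ I, ContDiff ℝ ∞ fun p ↦ S p I) :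
    ContDiff ℝ ∞ (covecOf S) := by
  unfold covecOf
  exact ContDiff.sum fun m _ ↦ (hS (uidx m)).smul contDiff_const

/-- **The derivative of `Θ`**: `DΘ_p(X)(w) = Σ_m D(S(m))_p(X) wᵐ`. [folklore] -/
theorem fderiv_covecOf_apply {S : Pt 3 → (Unit → Option (Fin 3)) → ℝ}
    (hS : ∀ I, ContDiff ℝ ∞ fun p ↦ S p I) (p X w : Pt 3) :
    fderiv ℝ (covecOf S) p X w = ∑ m, fderiv ℝ (fun q ↦ S q (uidx m)) p X * (waveBasis 3).coord m w := by
  have hd : ∀ m, DifferentiableAt ℝ (fun q ↦ S q (uidx m)) p := fun m ↦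
    (hS (uidx m)).differentiable (by simp) p
  have h : HasFDerivAt (covecOf S)
      (∑ m, (fderiv ℝ (fun q ↦ S q (uidx m)) p).smulRight (coordCLM (waveBasis 3) m)) p := by
    unfold covecOf
    exact HasFDerivAt.fun_sum fun m _ ↦ (hd m).hasFDerivAt.smul_const _
  rw [h.fderiv]
  simp [coordCLM_apply]

/-- `DΘ_p(X)(e₀) = D(S(none))_p(X)`. [folklore] -/
theorem fderiv_covecOf_tvec {S : Pt 3 → (Unit → Option (Fin 3)) → ℝ}
    (hS : ∀ I, ContDiff ℝ ∞ fun p ↦ S p I) (p X : Pt 3) :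
    fderiv ℝ (covecOf S) p X tvec = fderiv ℝ (fun q ↦ S q (uidx none)) p X := by
  rw [fderiv_covecOf_apply hS, Fintype.sum_option]
  simp only [sliceBasis_coord_none, sliceBasis_coord_some]
  simp

/-- `DΘ_p(X)(ṽ) = Σᵢ D(S(some i))_p(X) vᵢ`. [folklore] -/
theorem fderiv_covecOf_svec {S : Pt 3 → (Unit → Option (Fin 3)) → ℝ}
    (hS : ∀ I, ContDiff ℝ ∞ fun p ↦ S p I) (p X : Pt 3) (v : E3) :
    fderiv ℝ (covecOf S) p X (svec v) = ∑ i, fderiv ℝ (fun q ↦ S q (uidx (some i))) p X * v i := by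
  rw [fderiv_covecOf_apply hS, Fintype.sum_option]
  simp only [sliceBasis_coord_none, sliceBasis_coord_some]
  simp [stdBasis, EuclideanSpace.basisFun_repr]

end Covector

/-! ### Smoothness of the curvature coefficients of the deformation wave equation -/

section Curv

variable {ι : Type*} [Fintype ι] {E : Type*} [NormedAddCommGroup E] [NormedSpace ℝ E]
  [FiniteDimensional ℝ E] [CompleteSpace E] {G : E → E →L[ℝ] E →L[ℝ] ℝ} {b : Module.Basis ι ℝ E}
  {V : Set E}

/-- The curvature coefficients `X^{qm}_{ia}` are `C^∞` on `V`. [cite: FischerMarsdenMoncrief1980, proof of Lemma 2.2] -/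
theorem IsMetricOn.contDiffOn_deformCurv (hG : IsMetricOn G V) (q m i a : ι) :
    ContDiffOn ℝ ∞ (fun x ↦ deformCurv G b x q m i a) V := by
  unfold deformCurv
  refine ContDiffOn.sum fun p _ ↦ ContDiffOn.sum fun d _ ↦ ?_
  exact ((hG.contDiffOn_ginv b p q).mul (hG.contDiffOn_ginv b m d)).mul (hG.tsmoothOn_rm4 (b := b) _)

end Curv

/-! ### The main theorem -/

section Main

variable {G : Pt 3 → Pt 3 →L[ℝ] Pt 3 →L[ℝ] ℝ} {T : Set (Pt 3)} {B : Set E3}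

/-- `dim E3 ≠ 1`. [folklore] -/
theorem finrank_E3_ne_one : Module.finrank ℝ E3 ≠ 1 := by
  rw [finrank_euclideanSpace_fin]; norm_num

/-- The coordinate Killing form `Q(v, w) = DG(ξ)(v, w) + G(Dξ v, w) + G(v, Dξ w)` as a bilinear map.
[cite: Wald1984, (C.2.16)] -/
def killingForm (G : Pt 3 → Pt 3 →L[ℝ] Pt 3 →L[ℝ] ℝ) (ξ : Pt 3 → Pt 3) (x : Pt 3) : Pt 3 →L[ℝ] Pt 3 →L[ℝ] ℝ :=
  fderiv ℝ G x (ξ x) + (G x).comp (fderiv ℝ ξ x) + ((G x).flip.comp (fderiv ℝ ξ x)).flip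

/-- Unfolding lemma for `killingForm`. [cite: Wald1984, (C.2.16)] -/
theorem killingForm_apply (G : Pt 3 → Pt 3 →L[ℝ] Pt 3 →L[ℝ] ℝ) (ξ : Pt 3 → Pt 3) (x v w : Pt 3) :
    killingForm G ξ x v w = fderiv ℝ G x (ξ x) v w + G x (fderiv ℝ ξ x v) w + G x v (fderiv ℝ ξ x w) := by
  simp [killingForm, flip_apply]

/-- **The Killing defect of `Θ = G(ξ, ·)` is the coordinate Killing form of `ξ`**:
`kdef Θ (v, w) = DG(ξ)(v,w) + G(Dξ v, w) + G(v, Dξ w)`. [cite: Wald1984, (C.2.16)] -/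
theorem IsMetricOn.kdef_eq_killingForm (hG : IsMetricOn G T) {x : Pt 3} (hx : x ∈ T)
    {Θ : Pt 3 → Pt 3 →L[ℝ] ℝ} {ξ : Pt 3 → Pt 3} (hξ : DifferentiableAt ℝ ξ x)
    (hΘξ : Θ =ᶠ[𝓝 x] fun p ↦ G p (ξ p)) (v w : Pt 3) :
    kdef G Θ x v w = killingForm G ξ x v w := by
  have hGd := hG.differentiableAt hx
  have h : HasFDerivAt (fun p ↦ G p (ξ p)) ((G x).comp (fderiv ℝ ξ x) + (fderiv ℝ G x).flip (ξ x)) x :=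
    hGd.hasFDerivAt.clm_apply hξ.hasFDerivAt
  have hD : fderiv ℝ Θ x = (G x).comp (fderiv ℝ ξ x) + (fderiv ℝ G x).flip (ξ x) := by
    rw [hΘξ.fderiv_eq, h.fderiv]
  have hΘx : Θ x = G x (ξ x) := hΘξ.eq_of_nhds
  rw [kdef_apply, hD, hΘx, killingForm_apply, hG.symm x hx (ξ x) (chrAt G x v w),
    apply_chrAt (hG.isInvertible x hx), koszulCLM_apply]
  simp only [_root_.add_apply, ContinuousLinearMap.comp_apply, ContinuousLinearMap.flip_apply]
  rw [hG.fderiv_symm hx v (ξ x) w, hG.fderiv_symm hx w (ξ x) v, hG.fderiv_symm hx (ξ x) v w,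
    hG.symm x hx (fderiv ℝ ξ x w) v]
  ring

/-- **Killing initial data develop into coordinate Killing fields** (Moncrief 1975, §III;
Fischer–Marsden–Moncrief 1980, Lemma 2.2), coordinate form in a second-order Gaussian chart:
see the module docstring. [cite: Moncrief1975, §III] [cite: FischerMarsdenMoncrief1980, Lemma 2.2] -/
theorem GaussSlice.exists_coordKilling_of_kid (hG : IsMetricOn G T) (hB : IsOpen B)
    (hBT : ∀ y ∈ B, svec y ∈ T) (hS : IsGaussianSlice G B) (hRic : ∀ p ∈ T, ricAt G p = 0)
    (hham : ∀ y ∈ B, hamAt (sliceMetric G) (sliceK G) y = 0)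
    (hmom : ∀ y ∈ B, ∀ Z, momFn (stdBasis 3) (sliceMetric G) (sliceK G) y Z = 0)
    (hpos : ∀ y ∈ B, ∀ v : E3, v ≠ 0 → 0 < sliceMetric G y v v) {y₀ : E3} (hy₀ : y₀ ∈ B) :
    ∃ ρs : ℝ, 0 < ρs ∧ closedBall y₀ ρs ⊆ B ∧
      ∀ ρ : ℝ, 0 < ρ → ρ ≤ ρs → ∀ (N : E3 → ℝ) (Y : E3 → E3),
        ContDiffOn ℝ ∞ N (ball y₀ ρ) → ContDiffOn ℝ ∞ Y (ball y₀ ρ) →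
        (∀ y ∈ ball y₀ ρ, adjHamK (sliceMetric G) (sliceK G) N y + adjMomKS (sliceMetric G) Y y = 0) →
        (∀ y ∈ ball y₀ ρ,
          adjHamG (sliceMetric G) (sliceK G) N y + adjMomGS (sliceMetric G) (sliceK G) Y y = 0) →
        ∀ 𝒩 : Set (Pt 3), IsOpen 𝒩 → (∀ y ∈ ball y₀ ρ, svec y ∈ 𝒩) →
        ∀ ρ₁ : ℝ, ρ₁ < ρ →
          ∃ W₀ : Set (Pt 3), IsOpen W₀ ∧ W₀ ⊆ T ∧ W₀ ⊆ 𝒩 ∧ (∀ y ∈ ball y₀ ρ₁, svec y ∈ W₀) ∧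
            ∃ ξ : Pt 3 → Pt 3, ContDiffOn ℝ ∞ ξ W₀ ∧
              (∀ x ∈ W₀, ∀ v w : Pt 3,
                fderiv ℝ G x (ξ x) v w + G x (fderiv ℝ ξ x v) w + G x v (fderiv ℝ ξ x w) = 0) ∧
              ∀ y ∈ ball y₀ ρ₁, ξ (svec y) = 0 → N y = 0 ∧ Y y = 0 := by
  have hT := hG.isOpen
  have hh := isMetricOn_sliceMetric hG hS hB hBT
  -- S1–S2: the existence radius at `(0, y₀)`
  have hhyp : IsSliceHyperbolic (waveBasis 3) (G (svec y₀)) :=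
    isSliceHyperbolic_of_isGaussianSlice (stdBasis 3) hG hS hB hBT hy₀ (hpos y₀ hy₀)
  obtain ⟨r, hr, hrT, hsol⟩ := hG.exists_tensorWave_solution (α := Unit) (hBT y₀ hy₀) hhyp
  -- S3: the radius
  obtain ⟨ε, hε, hεB⟩ : ∃ ε, 0 < ε ∧ closedBall y₀ ε ⊆ B := by
    obtain ⟨ε, hε, hεB⟩ := Metric.mem_nhds_iff.1 (hB.mem_nhds hy₀)
    exact ⟨ε / 2, by positivity, (closedBall_subset_ball (by linarith)).trans hεB⟩
  refine ⟨min ε (r / 2), lt_min hε (by positivity), (closedBall_subset_closedBall (min_le_left _ _)).trans hεB, ?_⟩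
  -- S4: the KID pair
  intro ρ hρ hρs N Y hN hY hk1 hk2 𝒩 h𝒩o h𝒩 ρ₁ hρ₁
  have hρε : ρ ≤ ε := hρs.trans (min_le_left _ _)
  have hρr : ρ < r := by
    have := hρs.trans (min_le_right _ _); linarith
  have hballB : ball y₀ ρ ⊆ B := (ball_subset_closedBall.trans (closedBall_subset_closedBall hρε)).trans hεB
  set ρ₂ : ℝ := (max ρ₁ 0 + ρ) / 2 with hρ₂_def
  set ρ₃ : ℝ := (ρ₂ + ρ) / 2 with hρ₃_def
  have hmax : max ρ₁ 0 < ρ := max_lt hρ₁ hρ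
  have hρ₁₂ : ρ₁ < ρ₂ := by
    have := le_max_left ρ₁ 0; rw [hρ₂_def]; linarith
  have hρ₂pos : 0 < ρ₂ := by
    have := le_max_right ρ₁ 0; rw [hρ₂_def]; linarith
  have hρ₂₃ : ρ₂ < ρ₃ := by rw [hρ₃_def]; linarith
  have hρ₃ρ : ρ₃ < ρ := by rw [hρ₃_def]; linarith
  have hB₁B : ball y₀ ρ₂ ⊆ B := (ball_subset_ball (by linarith)).trans hballB
  have hB₁T : ∀ y ∈ ball y₀ ρ₂, svec y ∈ T := fun y hy ↦ hBT y (hB₁B hy)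
  -- S5: the cut-off
  let χ : ContDiffBump y₀ := ⟨ρ₂, ρ₃, hρ₂pos, hρ₂₃⟩
  have hχ1 : ∀ y ∈ closedBall y₀ ρ₂, χ y = 1 := fun y hy ↦ χ.one_of_mem_closedBall hy
  have hχ0 : ∀ y ∉ closedBall y₀ ρ₃, χ y = 0 := fun y hy ↦ by
    apply χ.zero_of_le_dist
    rw [mem_closedBall] at hy
    exact le_of_lt (not_le.1 hy)
  have hχs : ContDiff ℝ ∞ χ := χ.contDiff
  have hK : IsCompact (closedBall y₀ ρ₃) := isCompact_closedBall _ _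
  have hKc : IsClosed (closedBall y₀ ρ₃) := isClosed_closedBall
  have hKU : closedBall y₀ ρ₃ ⊆ ball y₀ ρ := closedBall_subset_ball hρ₃ρ
  have hKB : closedBall y₀ ρ₃ ⊆ B := hKU.trans hballB
  -- S6: the cut-off data
  set Nc : E3 → ℝ := fun y ↦ χ y * N y with hNc_def
  set Yc : E3 → E3 := fun y ↦ χ y • Y y with hYc_def
  have hNc : ContDiff ℝ ∞ Nc :=
    contDiff_of_contDiffOn_of_eq_zero isOpen_ball hKc hKU (hχs.contDiffOn.mul hN)
      fun y hy ↦ by simp [hNc_def, hχ0 y hy]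
  have hYc : ContDiff ℝ ∞ Yc :=
    contDiff_of_contDiffOn_of_eq_zero isOpen_ball hKc hKU (hχs.contDiffOn.smul hY)
      fun y hy ↦ by simp [hYc_def, hχ0 y hy]
  have hNc_eq : ∀ y ∈ ball y₀ ρ₂, Nc =ᶠ[𝓝 y] N := fun y hy ↦ by
    filter_upwards [isOpen_ball.mem_nhds hy] with z hz
    simp [hNc_def, hχ1 z (ball_subset_closedBall hz)]
  have hYc_eq : ∀ y ∈ ball y₀ ρ₂, Yc =ᶠ[𝓝 y] Y := fun y hy ↦ by
    filter_upwards [isOpen_ball.mem_nhds hy] with z hz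
    simp [hYc_def, hχ1 z (ball_subset_closedBall hz)]
  -- S7: the Cauchy data of `Θ`
  set S₀ : E3 → (Unit → Option (Fin 3)) → ℝ := fun y I ↦
    (I ()).elim (-2 * Nc y) (fun i ↦ sliceMetric G y (Yc y) (stdBasis 3 i)) with hS₀_def
  set S₁ : E3 → (Unit → Option (Fin 3)) → ℝ := fun y I ↦
    (I ()).elim 0 (fun i ↦ 2 * fderiv ℝ Nc y (stdBasis 3 i) + 2 * sliceK G y (stdBasis 3 i) (Yc y))
    with hS₁_def
  have hhY : ∀ v : E3, ContDiff ℝ ∞ fun y ↦ sliceMetric G y (Yc y) v := fun v ↦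
    contDiff_of_contDiffOn_of_eq_zero hB hKc hKB
      (((contDiffOn_sliceMetric hG.contDiffOn hBT).clm_apply hYc.contDiffOn).clm_apply contDiffOn_const)
      fun y hy ↦ by simp [hYc_def, hχ0 y hy]
  have hKY : ∀ v : E3, ContDiff ℝ ∞ fun y ↦ sliceK G y v (Yc y) := fun v ↦
    contDiff_of_contDiffOn_of_eq_zero hB hKc hKB
      (((contDiffOn_sliceK hG hBT).clm_apply contDiffOn_const).clm_apply hYc.contDiffOn)
      fun y hy ↦ by
        rw [show Yc y = 0 by simp [hYc_def, hχ0 y hy]]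
        exact map_zero _
  have hS₀s : ∀ I, ContDiff ℝ ∞ fun y ↦ S₀ y I := fun I ↦ by
    rcases hI : I () with _ | i
    · have : (fun y ↦ S₀ y I) = fun y ↦ -2 * Nc y := by funext y; simp [hS₀_def, hI]
      rw [this]; exact contDiff_const.mul hNc
    · have : (fun y ↦ S₀ y I) = fun y ↦ sliceMetric G y (Yc y) (stdBasis 3 i) := by
        funext y; simp [hS₀_def, hI]
      rw [this]; exact hhY _
  have hS₁s : ∀ I, ContDiff ℝ ∞ fun y ↦ S₁ y I := fun I ↦ by
    rcases hI : I () with _ | i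
    · have : (fun y ↦ S₁ y I) = fun _ ↦ (0 : ℝ) := by funext y; simp [hS₁_def, hI]
      rw [this]; exact contDiff_const
    · have : (fun y ↦ S₁ y I) = fun y ↦ 2 * fderiv ℝ Nc y (stdBasis 3 i) +
          2 * sliceK G y (stdBasis 3 i) (Yc y) := by
        funext y; simp [hS₁_def, hI]
      rw [this]
      exact (contDiff_const.mul ((hNc.fderiv_right (m := ∞) (by simp)).clm_apply contDiff_const)).add
        (contDiff_const.mul (hKY _))
  have hS₀c : ∀ I, HasCompactSupport fun y ↦ S₀ y I := fun I ↦
    hasCompactSupport_of_eq_zero hK fun y hy ↦ by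
      rcases hI : I () with _ | i <;> simp [hS₀_def, hI, hNc_def, hYc_def, hχ0 y hy]
  have hS₁c : ∀ I, HasCompactSupport fun y ↦ S₁ y I := fun I ↦
    hasCompactSupport_of_eq_zero hK fun y hy ↦ by
      rcases hI : I () with _ | i
      · simp [hS₁_def, hI]
      · have hN0 : fderiv ℝ Nc y = 0 := by
          refine fderiv_eq_zero_of_eqOn_const hKc.isOpen_compl (fun z hz ↦ ?_) hy (c := (0 : ℝ))
          simp [hNc_def, hχ0 z hz]
        simp [hS₁_def, hI, hYc_def, hχ0 y hy, hN0]
  -- S8: the wave solution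
  obtain ⟨S, hSs, hSw, hS0, hS1⟩ := hsol S₀ S₁ hS₀s hS₁s hS₀c hS₁c
  -- S9: the covector field
  set Θ : Pt 3 → Pt 3 →L[ℝ] ℝ := covecOf S with hΘ_def
  have hΘs : ContDiff ℝ ∞ Θ := contDiff_covecOf hSs
  have hcovec : covecComp (waveBasis 3) Θ = S := covecComp_covecOf S
  -- S10: the KID Cauchy data on `B₁ = ball y₀ ρ₂`
  have hval_t : ∀ y : E3, Θ (svec y) tvec = -2 * Nc y := fun y ↦ by
    rw [hΘ_def, covecOf_tvec, show svec y = (((0 : ℝ), y) : Pt 3) from rfl, hS0]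
    simp [hS₀_def]
  have hval_s : ∀ y v, Θ (svec y) (svec v) = sliceMetric G y (Yc y) v := fun y v ↦ by
    rw [hΘ_def, covecOf_svec, show svec y = (((0 : ℝ), y) : Pt 3) from rfl]
    simp only [hS0, hS₀_def, Option.elim]
    have hv : v = ∑ i, v i • (stdBasis 3 i : E3) := by
      conv_lhs => rw [← (stdBasis 3).sum_repr v]
      rfl
    conv_rhs => rw [hv]
    simp [map_sum, map_smul, mul_comm]
  have hdt_t : ∀ y : E3, fderiv ℝ Θ (svec y) tvec tvec = 0 := fun y ↦ by
    rw [hΘ_def, fderiv_covecOf_tvec hSs, show svec y = (((0 : ℝ), y) : Pt 3) from rfl,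
      show (tvec : Pt 3) = eT from rfl, hS1]
    simp [hS₁_def]
  have hdt_s0 : ∀ y v, fderiv ℝ Θ (svec y) (svec v) tvec = -2 * fderiv ℝ Nc y v := fun y v ↦ by
    rw [hΘ_def, fderiv_covecOf_tvec hSs]
    have hd : DifferentiableAt ℝ (fun q ↦ S q (uidx none)) (svec y) := (hSs _).differentiable (by simp) _
    rw [← fderiv_comp_svec hd]
    have hfun : (fun y' : E3 ↦ S (svec y') (uidx none)) = fun y' ↦ -2 * Nc y' := by
      funext y'
      rw [show svec y' = (((0 : ℝ), y') : Pt 3) from rfl, hS0]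
      simp [hS₀_def]
    rw [hfun, fderiv_const_mul ((hNc.differentiable (by simp)) y)]
    rfl
  have hD : IsKIDCauchyData G Θ Nc Yc (ball y₀ ρ₂) := by
    refine ⟨fun y _ ↦ hval_t y, fun y _ v ↦ hval_s y v, fun y _ ↦ hdt_t y, fun y hy v ↦ ?_⟩
    -- `∂_tΘ(ṽ) = 2 ∂_v N + 2 K(v, Y)`
    have hlhs : fderiv ℝ Θ (svec y) tvec (svec v) =
        2 * fderiv ℝ Nc y v + 2 * sliceK G y v (Yc y) := by
      rw [hΘ_def, fderiv_covecOf_svec hSs, show svec y = (((0 : ℝ), y) : Pt 3) from rfl,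
        show (tvec : Pt 3) = eT from rfl]
      simp only [hS1, hS₁_def, Option.elim]
      have hv : v = ∑ i, v i • (stdBasis 3 i : E3) := by
        conv_lhs => rw [← (stdBasis 3).sum_repr v]
        rfl
      conv_rhs => rw [hv]
      simp only [map_sum, map_smul, smul_eq_mul, Finset.mul_sum, ← Finset.sum_add_distrib,
        FunLike.coe_sum, Finset.sum_apply, FunLike.coe_smul, Pi.smul_apply]
      refine Finset.sum_congr rfl fun i _ ↦ ?_
      ring
    have hΓ : chrAt G (svec y) tvec (svec v) = svec (sharpAt (sliceMetric G) y (sliceK G y v)) :=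
      chrAt_tvec_svec hG hS hB hBT (hB₁B hy) v
    rw [hlhs, hdt_s0, hΓ, hval_s, hh.symm y (hB₁B hy), apply_sharpAt_apply (hh.isInvertible y (hB₁B hy))]
    ring
  -- S11: the Cauchy data of the Killing defect vanish on the slice
  have hS₁slice : IsGaussianSlice G (ball y₀ ρ₂) :=
    ⟨fun y hy ↦ hS.g00 y (hB₁B hy), fun y hy ↦ hS.g0x y (hB₁B hy), fun y hy ↦ hS.dg0 y (hB₁B hy)⟩
  have hkid₁ : ∀ y ∈ ball y₀ ρ₂,
      adjHamK (sliceMetric G) (sliceK G) Nc y + adjMomKS (sliceMetric G) Yc y = 0 := fun y hy ↦ by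
    rw [adjHamK_congr_of_eventuallyEq EventuallyEq.rfl EventuallyEq.rfl (hNc_eq y hy),
      adjMomKS_congr_of_eventuallyEq EventuallyEq.rfl (hYc_eq y hy)]
    exact hk1 y (ball_subset_ball (by linarith) hy)
  have hkid₂ : ∀ y ∈ ball y₀ ρ₂, adjHamG (sliceMetric G) (sliceK G) Nc y +
      adjMomGS (sliceMetric G) (sliceK G) Yc y = 0 := fun y hy ↦ by
    rw [adjHamG_congr_of_eventuallyEq EventuallyEq.rfl EventuallyEq.rfl (hNc_eq y hy),
      adjMomGS_congr_of_eventuallyEq EventuallyEq.rfl EventuallyEq.rfl (hYc_eq y hy)]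
    exact hk2 y (ball_subset_ball (by linarith) hy)
  have hslice_ball : ∀ y ∈ ball y₀ ρ₂, (((0 : ℝ), y) : Pt 3) ∈ ball (((0 : ℝ), y₀) : Pt 3) r := by
    intro y hy
    rw [mem_ball, Prod.dist_eq, dist_self]
    exact max_lt hr (by linarith [mem_ball.1 hy])
  have hwaveB : ∀ y ∈ ball y₀ ρ₂, ∀ I,
      tlap G (sliceBasis (stdBasis 3)) (covecComp (sliceBasis (stdBasis 3)) Θ) (svec y) I = 0 := by
    intro y hy I
    have h := (hSw y (hslice_ball y hy)).self_of_nhds I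
    rw [show sliceBasis (stdBasis 3) = waveBasis 3 from rfl, hcovec]
    exact h
  have hA0 : ∀ y ∈ ball y₀ ρ₂, ∀ a c : Option (Fin 3),
      deform G (waveBasis 3) S (svec y) (ocons a (uidx c)) = 0 ∧
      fderiv ℝ (fun x ↦ deform G (waveBasis 3) S x (ocons a (uidx c))) (svec y) tvec = 0 := by
    intro y hy a c
    have h := deform_cauchyData_eq_zero (stdBasis 3) hG hS₁slice isOpen_ball hB₁T finrank_E3_ne_one
      (fun y' hy' ↦ hRic _ (hB₁T y' hy')) hΘs.contDiffOn hD hNc.contDiffOn hYc.contDiffOn hkid₁ hkid₂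
      (fun y' hy' ↦ hham y' (hB₁B hy')) (fun y' hy' ↦ hmom y' (hB₁B hy') _) hwaveB hy a c
    rw [show sliceBasis (stdBasis 3) = waveBasis 3 from rfl, hcovec] at h
    exact h
  -- S12: the region where `□Θ = 0`, the defect `A` and its wave equation
  set O : Set (Pt 3) := {p | p ∈ T ∧ ∀ᶠ q in 𝓝 p, ∀ I, tlap G (waveBasis 3) S q I = 0} with hO_def
  have hO : IsOpen O := by
    refine isOpen_iff_mem_nhds.2 fun p hp ↦ ?_
    filter_upwards [hT.mem_nhds hp.1, hp.2.eventually_nhds] with q hq1 hq2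
    exact ⟨hq1, hq2⟩
  have hOT : O ⊆ T := fun p hp ↦ hp.1
  have hGO : IsMetricOn G O :=
    ⟨hO, hG.contDiffOn.mono hOT, fun x hx ↦ hG.symm x (hOT hx), fun x hx ↦ hG.isInvertible x (hOT hx)⟩
  have hRicO : ∀ p ∈ O, ricAt G p = 0 := fun p hp ↦ hRic p (hOT hp)
  have hSO : TSmoothOn S O := fun I ↦ (hSs I).contDiffOn
  have hwaveO : ∀ q ∈ O, ∀ I, tlap G (waveBasis 3) S q I = 0 := fun q hq I ↦ hq.2.self_of_nhds I
  have hsvecO : ∀ y ∈ ball y₀ ρ₂, svec y ∈ O := fun y hy ↦ ⟨hB₁T y hy, hSw y (hslice_ball y hy)⟩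
  set A : Pt 3 → (Option Unit → Option (Fin 3)) → ℝ := deform G (waveBasis 3) S with hA_def
  have hAO : TSmoothOn A O := hGO.tsmoothOn_deform hSO
  set L : Pt 3 → (Option Unit → Option (Fin 3)) → (Option Unit → Option (Fin 3)) → ℝ := fun p I J ↦
    -(deformCurv G (waveBasis 3) p (J none) (J (some ())) (I none) (I (some ())) +
      deformCurv G (waveBasis 3) p (J none) (J (some ())) (I (some ())) (I none)) with hL_def
  have hL : ∀ I J, ContDiffOn ℝ ∞ (fun p ↦ L p I J) O := fun I J ↦
    ((hGO.contDiffOn_deformCurv _ _ _ _).add (hGO.contDiffOn_deformCurv _ _ _ _)).neg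
  have heq : ∀ p ∈ O, ∀ I, tlap G (waveBasis 3) A p I = ∑ J, L p I J * A p J := by
    intro p hp I
    obtain ⟨i, a, rfl⟩ := exists_eq_ocons_uidx I
    rw [hA_def, hGO.tlap_deform_eq_of_tlap_eq_zero hRicO hSO hwaveO hp i a, sum_optionIndex]
    simp only [sum_unitIndex, hL_def, ocons_none, ocons_some, neg_mul, Finset.sum_neg_distrib]
  -- S13: uniqueness: `A = 0` near the slice
  have hAzero : ∀ x₁ ∈ ball y₀ ρ₂, ∀ᶠ p in 𝓝 (((0 : ℝ), x₁) : Pt 3), ∀ I, A p I = 0 := by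
    intro x₁ hx₁
    have hx₁B : x₁ ∈ B := hB₁B hx₁
    have ha : ginv G (waveBasis 3) ((0 : ℝ), x₁) none none < 0 := by
      rw [show waveBasis 3 = sliceBasis (stdBasis 3) from rfl,
        show (((0 : ℝ), x₁) : Pt 3) = svec x₁ from rfl, ginv_none_none (stdBasis 3) hG hS hBT hx₁B]
      norm_num
    obtain ⟨lam, hlam, hlamle⟩ := exists_pos_mul_sum_sq_le_mqf
      (mIsPosDef_ginv (stdBasis 3) (hh.isInvertible x₁ hx₁B) (hpos x₁ hx₁B))
    have hpos' : ∀ ξ : Fin 3 → ℝ, lam * ∑ i, ξ i ^ 2 ≤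
        ∑ i, ∑ j, ginv G (waveBasis 3) ((0 : ℝ), x₁) (some i) (some j) * (ξ i * ξ j) := by
      intro ξ
      have h := hlamle ξ
      simp only [mqf] at h
      rw [show waveBasis 3 = sliceBasis (stdBasis 3) from rfl,
        show (((0 : ℝ), x₁) : Pt 3) = svec x₁ from rfl]
      simp only [ginv_some_some (stdBasis 3) hG hS hB hBT hx₁B]
      calc lam * ∑ i, ξ i ^ 2 ≤ ∑ j, ∑ k, ginv (sliceMetric G) (stdBasis 3) x₁ j k * ξ j * ξ k := h
        _ = _ := Finset.sum_congr rfl fun j _ ↦ Finset.sum_congr rfl fun k _ ↦ by ring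
    have h0 : ∀ᶠ y in 𝓝 x₁, ∀ I, A ((0 : ℝ), y) I = 0 := by
      filter_upwards [isOpen_ball.mem_nhds hx₁] with y hy I
      obtain ⟨a, c, rfl⟩ := exists_eq_ocons_uidx I
      exact (hA0 y hy a c).1
    have h1 : ∀ᶠ y in 𝓝 x₁, ∀ I, fderiv ℝ (fun p ↦ A p I) ((0 : ℝ), y) eT = 0 := by
      filter_upwards [isOpen_ball.mem_nhds hx₁] with y hy I
      obtain ⟨a, c, rfl⟩ := exists_eq_ocons_uidx I
      exact (hA0 y hy a c).2
    exact hGO.eventually_eq_zero_of_tlap_eq (hsvecO x₁ hx₁) ha hlam hpos' hAO hL heq h0 h1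
  -- S14: the open set `W₀`
  set W₀ : Set (Pt 3) := {p | p ∈ O ∧ p ∈ 𝒩 ∧ ∀ᶠ q in 𝓝 p, ∀ I, A q I = 0} with hW₀_def
  have hW₀ : IsOpen W₀ := by
    refine isOpen_iff_mem_nhds.2 fun p hp ↦ ?_
    filter_upwards [hO.mem_nhds hp.1, h𝒩o.mem_nhds hp.2.1, hp.2.2.eventually_nhds] with q h1 h2 h3
    exact ⟨h1, h2, h3⟩
  have hW₀T : W₀ ⊆ T := fun p hp ↦ hOT hp.1
  have hW₀𝒩 : W₀ ⊆ 𝒩 := fun p hp ↦ hp.2.1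
  have hsvecW₀ : ∀ y ∈ ball y₀ ρ₁, svec y ∈ W₀ := fun y hy ↦
    have hy₂ : y ∈ ball y₀ ρ₂ := ball_subset_ball hρ₁₂.le hy
    ⟨hsvecO y hy₂, h𝒩 y (ball_subset_ball hρ₁.le hy), hAzero y hy₂⟩
  have hAW₀ : ∀ p ∈ W₀, ∀ I, A p I = 0 := fun p hp I ↦ hp.2.2.self_of_nhds I
  -- S15: the vector field `ξ = Θ♯` and its Killing equation on `W₀`
  set ξ : Pt 3 → Pt 3 := fun p ↦ sharpAt G p (Θ p) with hξ_def
  have hξs : ContDiffOn ℝ ∞ ξ T := hG.contDiffOn_sharpAt.clm_apply hΘs.contDiffOn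
  have hΘξ : ∀ x ∈ T, Θ =ᶠ[𝓝 x] fun p ↦ G p (ξ p) := fun x hx ↦ by
    filter_upwards [hT.mem_nhds hx] with p hp
    rw [hξ_def, apply_sharpAt (hG.isInvertible p hp)]
  have hkill : ∀ x ∈ W₀, ∀ v w : Pt 3,
      fderiv ℝ G x (ξ x) v w + G x (fderiv ℝ ξ x v) w + G x v (fderiv ℝ ξ x w) = 0 := by
    intro x hx v w
    have hxT := hW₀T hx
    have hξd : DifferentiableAt ℝ ξ x :=
      ((hξs x hxT).contDiffAt (hT.mem_nhds hxT)).differentiableAt (by simp)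
    have hΘd : DifferentiableAt ℝ Θ x := (hΘs.differentiable (by simp)) x
    have hbasis : ∀ j i, killingForm G ξ x (waveBasis 3 j) (waveBasis 3 i) = 0 := fun j i ↦ by
      rw [← hG.kdef_eq_killingForm hxT hξd (hΘξ x hxT),
        ← hG.deform_covecComp (b := waveBasis 3) hxT hΘd j i, hcovec]
      exact hAW₀ x hx _
    have hv : v = ∑ j, (waveBasis 3).repr v j • waveBasis 3 j := ((waveBasis 3).sum_repr v).symm
    have hw : w = ∑ i, (waveBasis 3).repr w i • waveBasis 3 i := ((waveBasis 3).sum_repr w).symm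
    have h : killingForm G ξ x v w = 0 := by
      rw [hv, hw, map_sum]
      simp only [map_smul, FunLike.coe_sum, Finset.sum_apply, FunLike.coe_smul,
        Pi.smul_apply, map_sum, smul_eq_mul, hbasis, mul_zero, Finset.sum_const_zero]
    rwa [killingForm_apply] at h
  -- S16: conclusion
  refine ⟨W₀, hW₀, hW₀T, hW₀𝒩, hsvecW₀, ξ, hξs.mono hW₀T, hkill, fun y hy hξ0 ↦ ?_⟩
  have hyB₂ : y ∈ ball y₀ ρ₂ := ball_subset_ball hρ₁₂.le hy
  have hyB : y ∈ B := hB₁B hyB₂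
  have hχy : χ y = 1 := hχ1 y (ball_subset_closedBall hyB₂)
  have hΘ0 : Θ (svec y) = 0 := by
    have h := apply_sharpAt (hG.isInvertible _ (hBT y hyB)) (Θ (svec y))
    rw [show sharpAt G (svec y) (Θ (svec y)) = ξ (svec y) from rfl, hξ0, map_zero] at h
    exact h.symm
  have hNy : N y = 0 := by
    have h := hval_t y
    rw [hΘ0, _root_.zero_apply] at h
    have hNc0 : Nc y = 0 := by linarith
    simpa [hNc_def, hχy] using hNc0
  have hYc0 : Yc y = 0 := by
    obtain ⟨e, he⟩ := hh.isInvertible y hyB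
    have h1 : ∀ v, sliceMetric G y (Yc y) v = 0 := fun v ↦ by
      rw [← hval_s y v, hΘ0]; rfl
    have h2 : (e : E3 →L[ℝ] E3 →L[ℝ] ℝ) (Yc y) = 0 := by
      rw [he]; exact ContinuousLinearMap.ext h1
    have h3 : e (Yc y) = e 0 := by
      rw [map_zero]; exact h2
    exact e.injective h3
  have hYy : Y y = 0 := by
    have h : χ y • Y y = 0 := hYc0
    rwa [hχy, one_smul] at h
  exact ⟨hNy, hYy⟩

end Main

end MetricCoord

end Literature.Geometry.Lorentzian

end
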